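import Summits.CriticalPhenomena.Ising3DConformalLimit.Theses.PerfectScreening
import Summits.CriticalPhenomena.Ising3DConformalLimit.Theses.PlantedPinning
import Summits.CriticalPhenomena.Ising3DConformalLimit.Theses.SubPtolemyInterlacing
import Summits.CriticalPhenomena.Ising3DConformalLimit.Theses.EnergyNotSigmaSquared
import Summits.CriticalPhenomena.Ising3DConformalLimit.Theses.HyperoctahedralRP
import Summits.CriticalPhenomena.Ising3DConformalLimit.Theses.PrimaryAtInfinity
import Summits.CriticalPhenomena.Ising3DConformalLimit.Theses.WeylWindow
import Summits.CriticalPhenomena.Ising3DConformalLimit.Theorems.PerfectScreeningMoebiusLimitExistsSketchReduction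
import Summits.CriticalPhenomena.Ising3DConformalLimit.Theorems.PrecisionLaplacianMoebiusLimitOfTwoPointLawWardToMoebius
import Summits.CriticalPhenomena.Ising3DConformalLimit.Theorems.PrimaryAtInfinityMultipoleToWard
import Summits.CriticalPhenomena.Ising3DConformalLimit.Theorems.PrimaryAtInfinityTwoPointPowerLawEta
import Summits.CriticalPhenomena.Ising3DConformalLimit.Theorems.PrecisionLaplacianMoebiusLimitOfTwoPointLawRegularOfLimitExists
import Summits.CriticalPhenomena.Ising3DConformalLimit.Theorems.MoebiusLimitExists.Negative.MeshContinuity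
import Summits.CriticalPhenomena.Ising3DConformalLimit.Theorems.ExistsScaleCovariantLimit.Negative.DeltaDetermined
import Literature.Probability.LatticeModels.SCTWardIdentity
import Literature.MathematicalPhysics.QuantumFieldTheory.PointwiseOSReconstruction
import HarnessLib

/-!
# The Ward door for crux `MoebiusLimitExists` (stmt-CriticalPhenomena-1344) and item 1982 `InversionUpgradeNormalised`
(line `Sketch` v9, lead prover-line-stmt-CriticalPhenomena-1344-c16-0; THEOREM-ONLY, `--supports stmt-CriticalPhenomena-1344`)

Every earlier seat on this crux reduced it to `ExistsScaleCovariantLimit (item 1981) ∧ 7′`, where 7′ is the POINTWISE inversion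
(special conformal) upgrade for the Ising₃ `σ`-sector (≡ item 1982, `MoebiusLimitExistsSketch.inversionUpgradeNormalised_iff_interiorStrict`).
The tree meanwhile acquired — on route `PrimaryAtInfinity`, for crux 4801 — the two ANALYSIS items of that route as theorems:
`wardToMoebius` (item 5357: the weak special-conformal Ward identities, with translations, parity and continuity, INTEGRATE to
`IsMoebiusCovariant Δ S`) and `multipoleToWard_proof` (item 5356), together with the Literature notion
`Literature.Probability.LatticeModels.SCTWardWeak`.  This file opens that door for crux 1344 and item 1982:

* `isMoebiusCovariant_of_sctWardWeak` — `wardToMoebius` in the vocabulary of `SCTWardWeak` (coefficient `2Δ − 2d` at `d = 3`);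
  `continuousOn_of_limit`, `parity_of_euclidean` — the two soft hypotheses are free for Euclidean-invariant pointwise limits.
* **7″ ⇒ 7′** (`interiorInversionUpgradeStrict_of_wardStrict`): on the interacting open-window stratum with the OS and clustering
  premises, the WEAK SPECIAL-CONFORMAL WARD IDENTITIES `∀ n, SCTWardWeak S Δ n` already give `IsInversionCovariant Δ S`; hence
  **1982 ⇐ 7″** (`inversionUpgradeNormalised_of_wardStrict`, `…_of_wardUpgrade`) and **crux ⇐ 1981 ∧ 7″**
  (`MoebiusLimitExists_of_existence_of_wardStrict`, three route spellings).  7″ is the LOCAL, LINEAR (first-order PDE in the weak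
  sense) form of the conjecture content — the statement a lattice Ward identity / discrete stress tensor would deliver in the limit.
* **Cross-route edges through route PrimaryAtInfinity's two Ward-content cruxes** (items 5352 `FirstMultipoleIdentity`, 5353
  `FarFieldClustering`): `sctWardWeak_of_multipole` (every normalised non-degenerate pointwise limit satisfies the Ward identities with
  its own two-point dimension — `twoPoint_structure_of_limit` supplies the isotropic two-point law WITHOUT item 0634),
  **1982 ⇐ 5352 ∧ 5353** (`inversionUpgradeNormalised_of_multipole`, dimensions matched by `delta_unique`), and
  **crux ⇐ LimitExists (item 4738, BARE existence) ∧ 5352 ∧ 5353** (`MoebiusLimitExists_of_limitExists_of_multipole`, hence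
  `MoebiusLimitExists_iff_limitExists_of_multipole`; the 1981 version and the PlantedPinning / SubPtolemyInterlacing /
  EnergyNotSigmaSquared spellings).  A third child set for the planners' split of 1344, with bare existence on the existence side.

Not here (registered as stubs F0/F1/F2 of skeleton v9, `Cruxes/MoebiusLimitExists/Lines/Sketch.lean`): the textbook converse
"Möbius covariance + continuity ⇒ weak SCT Ward identity", which makes the door TIGHT (crux ⟺ 1981 ∧ 7″).

References: Di Francesco–Mathieu–Sénéchal 1997 §4.1 (4.14)–(4.19), §4.3.1 (4.51)–(4.54) [FrancescoMathieuSenechal1997];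
Lüscher–Mack 1975 (infinitesimal ⇒ global) [LuscherMack1975]; Duminil-Copin ICM 2022 §8.4 [DuminilCopinICM2022].  No definitions,
no `sorry`.
-/

noncomputable section

namespace Summit.CriticalPhenomena.Ising3DConformalLimit.MoebiusLimitExistsWardDoor

open Filter Topology MeasureTheory
open Literature.Probability.LatticeModels Literature.MathematicalPhysics.QuantumFieldTheory
open Literature.Barriers.CriticalPhenomena.ScaleNotMoebius (axisUnit zero_axisUnit_mem_nonCoincident)
open Summit.CriticalPhenomena.Ising3DConformalLimit.Theses
open Summit.CriticalPhenomena.Ising3DConformalLimit.PrecisionLaplacianMoebiusLimitOfTwoPointLaw (wardToMoebius)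
open Summit.CriticalPhenomena.Ising3DConformalLimit.Theorems (multipoleToWard_proof)
open Summit.CriticalPhenomena.Ising3DConformalLimit.Theorems.PrimaryAtInfinityTwoPointPowerLawEta
  (twoPoint_structure_of_limit)
open Summit.CriticalPhenomena.Ising3DConformalLimit.MoebiusLimitExistsSketch
  (inversionUpgradeNormalised_of_interiorStrict MoebiusLimitExists_of_existence_of_interiorStrict)
open Summit.CriticalPhenomena.Ising3DConformalLimit.ExistsScaleCovariantLimitNegative (delta_unique)

/-! ## The door: weak special-conformal Ward identities integrate (item 5357, landed) -/

/-- The coefficient of `SCTWardWeak` at `d = 3` is `2Δ − 6`. [folklore] -/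
theorem coeff_three (Δ : ℝ) : 2 * Δ - 2 * ((3 : ℕ) : ℝ) = 2 * Δ - 6 := by push_cast; ring

/-- `SCTWardWeak S Δ n` on `ℝ³`, unfolded with the coefficient `2Δ − 6` (the form inlined in items 5352/5356/5357).
[cite: FrancescoMathieuSenechal1997, §4.3.1 (4.51)–(4.54)] -/
theorem sctWardWeak_three_iff (S : CorrFamily 3) (Δ : ℝ) (n : ℕ) :
    SCTWardWeak S Δ n ↔
      ∀ (b : EuclideanSpace ℝ (Fin 3)) (φ : (Fin n → EuclideanSpace ℝ (Fin 3)) → ℝ),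
        ContDiff ℝ ((⊤ : ℕ∞) : WithTop ℕ∞) φ → HasCompactSupport φ → tsupport φ ⊆ NonCoincident 3 n →
          ∫ x, S n x * ((2 * Δ - 6) * (∑ i, inner ℝ b (x i)) * φ x +
            fderiv ℝ φ x (fun i => ‖x i‖ ^ 2 • b - (2 * inner ℝ b (x i)) • x i)) = 0 :=
  sctWardWeak_iff_coeff S Δ n (coeff_three Δ)

/-- **Weak special-conformal Ward identities integrate to Möbius covariance** (`wardToMoebius`, item 5357, in the vocabulary of
`SCTWardWeak`): a normalised family, continuous off the diagonals, translation and parity invariant, satisfying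
`SCTWardWeak S Δ n` for every `n`, is `IsMoebiusCovariant Δ S`. [cite: LuscherMack1975, Thm 1] -/
theorem isMoebiusCovariant_of_sctWardWeak {Δ : ℝ} {S : CorrFamily 3}
    (hnorm : ∀ n z, z ∉ NonCoincident 3 n → S n z = 0) (hcont : ∀ n, ContinuousOn (S n) (NonCoincident 3 n))
    (htr : IsTranslationInvariant S) (hpar : ∀ n (x : Fin n → EuclideanSpace ℝ (Fin 3)), S n (fun i => -(x i)) = S n x)
    (hW : ∀ n, SCTWardWeak S Δ n) : IsMoebiusCovariant Δ S :=
  wardToMoebius S Δ hnorm hcont htr hpar fun n b φ hφ hc hs => (sctWardWeak_three_iff S Δ n).1 (hW n) b φ hφ hc hs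

/-- Every pointwise scaling limit of the critical `ℤ³` correlators is continuous off the diagonals (mesh continuity + free
translations, `LimitMeshContinuity.continuousOn_limit`). [folklore] -/
theorem continuousOn_of_limit {ρ : ℝ → ℝ} {S : CorrFamily 3} (hlim : HasPointwiseScalingLimit (criticalCorr 3) ρ S) :
    ∀ n, ContinuousOn (S n) (NonCoincident 3 n) :=
  LimitMeshContinuity.continuousOn_limit hlim

/-- Parity is a linear isometry, so a Euclidean-invariant family (`O(3)` convention) is parity invariant. [folklore] -/
theorem parity_of_euclidean {S : CorrFamily 3} (heuc : IsEuclideanInvariant S) :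
    ∀ n (x : Fin n → EuclideanSpace ℝ (Fin 3)), S n (fun i => -(x i)) = S n x := fun n x => by
  simpa using heuc.2 n (LinearIsometryEquiv.neg ℝ) x

/-- **Ward ⇒ Möbius for Euclidean-invariant normalised pointwise limits**: the soft hypotheses of the door are free.
[cite: LuscherMack1975, Thm 1] -/
theorem isMoebiusCovariant_of_limit_of_sctWardWeak {ρ : ℝ → ℝ} {Δ : ℝ} {S : CorrFamily 3}
    (hlim : HasPointwiseScalingLimit (criticalCorr 3) ρ S) (hnorm : ∀ n z, z ∉ NonCoincident 3 n → S n z = 0)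
    (heuc : IsEuclideanInvariant S) (hW : ∀ n, SCTWardWeak S Δ n) : IsMoebiusCovariant Δ S :=
  isMoebiusCovariant_of_sctWardWeak hnorm (continuousOn_of_limit hlim) heuc.1 (parity_of_euclidean heuc) hW

/-! ## 7″ ⇒ 7′ ⇒ item 1982 ⇒ the crux (given item 1981) -/

/-- **7″ ⇒ 7′.** On the interacting open-window stratum (`1/2 < Δ ≤ 3/4`, `U₄ ≢ 0`) with the pointwise OS premises and clustering as
free hypotheses, the weak special-conformal Ward identities for a normalised Euclidean scale-covariant pointwise limit give its
inversion covariance — the registered stub 7′ `stub_interiorInversionUpgradeStrict` of skeleton v8 follows from the Ward-form stub 7″.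
[cite: FrancescoMathieuSenechal1997, §4.3.1 eq. (4.62)] -/
theorem interiorInversionUpgradeStrict_of_wardStrict
    (h7 : ∀ (ρ : ℝ → ℝ) (Δ : ℝ) (S : CorrFamily 3), (∀ δ ∈ Set.Ioc (0:ℝ) 1, 0 < ρ δ) →
      HasPointwiseScalingLimit (criticalCorr 3) ρ S → (∀ n z, z ∉ NonCoincident 3 n → S n z = 0) →
      IsNondegenerateTwoPoint S → IsEuclideanInvariant S → IsScaleCovariant Δ S →
      1 / 2 < Δ → Δ ≤ 3 / 4 → HasNontrivialU4 S →
      (∀ τ : Fin 3, PointwiseOSReconstruction τ S) →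
      (∀ (n m : ℕ) (x : Fin n → EuclideanSpace ℝ (Fin 3)) (y : Fin m → EuclideanSpace ℝ (Fin 3))
        (v : EuclideanSpace ℝ (Fin 3)), v ≠ 0 →
        Tendsto (fun t : ℝ => S (n + m) (Fin.append x (fun j => y j + t • v)) - S n x * S m y)
          atTop (𝓝 0)) →
      ∀ n, SCTWardWeak S Δ n) :
    ∀ (ρ : ℝ → ℝ) (Δ : ℝ) (S : CorrFamily 3), (∀ δ ∈ Set.Ioc (0:ℝ) 1, 0 < ρ δ) →
      HasPointwiseScalingLimit (criticalCorr 3) ρ S → (∀ n z, z ∉ NonCoincident 3 n → S n z = 0) →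
      IsNondegenerateTwoPoint S → IsEuclideanInvariant S → IsScaleCovariant Δ S →
      1 / 2 < Δ → Δ ≤ 3 / 4 → HasNontrivialU4 S →
      (∀ τ : Fin 3, PointwiseOSReconstruction τ S) →
      (∀ (n m : ℕ) (x : Fin n → EuclideanSpace ℝ (Fin 3)) (y : Fin m → EuclideanSpace ℝ (Fin 3))
        (v : EuclideanSpace ℝ (Fin 3)), v ≠ 0 →
        Tendsto (fun t : ℝ => S (n + m) (Fin.append x (fun j => y j + t • v)) - S n x * S m y)
          atTop (𝓝 0)) →
      IsInversionCovariant Δ S :=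
  fun ρ Δ S hρ hlim hnorm hnd heuc hsc hlt hle hU4 hos hcl =>
    (isMoebiusCovariant_of_limit_of_sctWardWeak hlim hnorm heuc
      (h7 ρ Δ S hρ hlim hnorm hnd heuc hsc hlt hle hU4 hos hcl)).isInversionCovariant

/-- **Item 1982 ⇐ 7″** (7″ ⇒ 7′ ⇒ 1982 by the landed `inversionUpgradeNormalised_of_interiorStrict`: 1982's stubs 1–6, the sharp window,
the edge `Δ = 1/2` and the Gaussian locus are theorems). [cite: FrancescoMathieuSenechal1997, §4.3.1 eq. (4.62)] -/
theorem inversionUpgradeNormalised_of_wardStrict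
    (h7 : ∀ (ρ : ℝ → ℝ) (Δ : ℝ) (S : CorrFamily 3), (∀ δ ∈ Set.Ioc (0:ℝ) 1, 0 < ρ δ) →
      HasPointwiseScalingLimit (criticalCorr 3) ρ S → (∀ n z, z ∉ NonCoincident 3 n → S n z = 0) →
      IsNondegenerateTwoPoint S → IsEuclideanInvariant S → IsScaleCovariant Δ S →
      1 / 2 < Δ → Δ ≤ 3 / 4 → HasNontrivialU4 S →
      (∀ τ : Fin 3, PointwiseOSReconstruction τ S) →
      (∀ (n m : ℕ) (x : Fin n → EuclideanSpace ℝ (Fin 3)) (y : Fin m → EuclideanSpace ℝ (Fin 3))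
        (v : EuclideanSpace ℝ (Fin 3)), v ≠ 0 →
        Tendsto (fun t : ℝ => S (n + m) (Fin.append x (fun j => y j + t • v)) - S n x * S m y)
          atTop (𝓝 0)) →
      ∀ n, SCTWardWeak S Δ n) :
    HyperoctahedralRP.InversionUpgradeNormalised :=
  inversionUpgradeNormalised_of_interiorStrict (interiorInversionUpgradeStrict_of_wardStrict h7)

/-- **Item 1982 ⇐ the bare Ward upgrade** (no window, `U₄`, OS or clustering hypotheses): if every normalised non-degenerate Euclidean
scale-covariant pointwise limit satisfies the weak special-conformal Ward identities, item 1982 holds.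
[cite: FrancescoMathieuSenechal1997, §4.3.1 eq. (4.62)] -/
theorem inversionUpgradeNormalised_of_wardUpgrade
    (hW : ∀ (ρ : ℝ → ℝ) (Δ : ℝ) (S : CorrFamily 3), (∀ δ ∈ Set.Ioc (0:ℝ) 1, 0 < ρ δ) →
      HasPointwiseScalingLimit (criticalCorr 3) ρ S → (∀ n z, z ∉ NonCoincident 3 n → S n z = 0) →
      IsNondegenerateTwoPoint S → IsEuclideanInvariant S → IsScaleCovariant Δ S → ∀ n, SCTWardWeak S Δ n) :
    HyperoctahedralRP.InversionUpgradeNormalised :=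
  fun ρ Δ S hρ hlim hnorm hnd heuc hsc =>
    (isMoebiusCovariant_of_limit_of_sctWardWeak hlim hnorm heuc (hW ρ Δ S hρ hlim hnorm hnd heuc hsc)).isInversionCovariant

/-- **The crux ⇐ item 1981 ∧ 7″** (composition of skeleton v9 of line `Sketch`: two-leaf glue p137285 ∘ reduction p139739 ∘ the door).
[cite: DuminilCopinICM2022, §8.4] -/
theorem MoebiusLimitExists_of_existence_of_wardStrict
    (hE : HyperoctahedralRP.ExistsScaleCovariantLimit)
    (h7 : ∀ (ρ : ℝ → ℝ) (Δ : ℝ) (S : CorrFamily 3), (∀ δ ∈ Set.Ioc (0:ℝ) 1, 0 < ρ δ) →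
      HasPointwiseScalingLimit (criticalCorr 3) ρ S → (∀ n z, z ∉ NonCoincident 3 n → S n z = 0) →
      IsNondegenerateTwoPoint S → IsEuclideanInvariant S → IsScaleCovariant Δ S →
      1 / 2 < Δ → Δ ≤ 3 / 4 → HasNontrivialU4 S →
      (∀ τ : Fin 3, PointwiseOSReconstruction τ S) →
      (∀ (n m : ℕ) (x : Fin n → EuclideanSpace ℝ (Fin 3)) (y : Fin m → EuclideanSpace ℝ (Fin 3))
        (v : EuclideanSpace ℝ (Fin 3)), v ≠ 0 →
        Tendsto (fun t : ℝ => S (n + m) (Fin.append x (fun j => y j + t • v)) - S n x * S m y)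
          atTop (𝓝 0)) →
      ∀ n, SCTWardWeak S Δ n) :
    PerfectScreening.MoebiusLimitExists :=
  MoebiusLimitExists_of_existence_of_interiorStrict hE (interiorInversionUpgradeStrict_of_wardStrict h7)

/-- The same in route PlantedPinning's spelling (byte-identical definiens). [cite: DuminilCopinICM2022, §8.4] -/
theorem plantedPinning_MoebiusLimitExists_of_existence_of_wardStrict
    (hE : HyperoctahedralRP.ExistsScaleCovariantLimit)
    (h7 : ∀ (ρ : ℝ → ℝ) (Δ : ℝ) (S : CorrFamily 3), (∀ δ ∈ Set.Ioc (0:ℝ) 1, 0 < ρ δ) →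
      HasPointwiseScalingLimit (criticalCorr 3) ρ S → (∀ n z, z ∉ NonCoincident 3 n → S n z = 0) →
      IsNondegenerateTwoPoint S → IsEuclideanInvariant S → IsScaleCovariant Δ S →
      1 / 2 < Δ → Δ ≤ 3 / 4 → HasNontrivialU4 S →
      (∀ τ : Fin 3, PointwiseOSReconstruction τ S) →
      (∀ (n m : ℕ) (x : Fin n → EuclideanSpace ℝ (Fin 3)) (y : Fin m → EuclideanSpace ℝ (Fin 3))
        (v : EuclideanSpace ℝ (Fin 3)), v ≠ 0 →
        Tendsto (fun t : ℝ => S (n + m) (Fin.append x (fun j => y j + t • v)) - S n x * S m y)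
          atTop (𝓝 0)) →
      ∀ n, SCTWardWeak S Δ n) :
    PlantedPinning.MoebiusLimitExists :=
  MoebiusLimitExists_of_existence_of_wardStrict hE h7

/-- The same in route SubPtolemyInterlacing's spelling (decl `MoebiusLimit`, byte-identical definiens). [cite: DuminilCopinICM2022, §8.4] -/
theorem subPtolemyInterlacing_MoebiusLimit_of_existence_of_wardStrict
    (hE : HyperoctahedralRP.ExistsScaleCovariantLimit)
    (h7 : ∀ (ρ : ℝ → ℝ) (Δ : ℝ) (S : CorrFamily 3), (∀ δ ∈ Set.Ioc (0:ℝ) 1, 0 < ρ δ) →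
      HasPointwiseScalingLimit (criticalCorr 3) ρ S → (∀ n z, z ∉ NonCoincident 3 n → S n z = 0) →
      IsNondegenerateTwoPoint S → IsEuclideanInvariant S → IsScaleCovariant Δ S →
      1 / 2 < Δ → Δ ≤ 3 / 4 → HasNontrivialU4 S →
      (∀ τ : Fin 3, PointwiseOSReconstruction τ S) →
      (∀ (n m : ℕ) (x : Fin n → EuclideanSpace ℝ (Fin 3)) (y : Fin m → EuclideanSpace ℝ (Fin 3))
        (v : EuclideanSpace ℝ (Fin 3)), v ≠ 0 →
        Tendsto (fun t : ℝ => S (n + m) (Fin.append x (fun j => y j + t • v)) - S n x * S m y)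
          atTop (𝓝 0)) →
      ∀ n, SCTWardWeak S Δ n) :
    SubPtolemyInterlacing.MoebiusLimit :=
  MoebiusLimitExists_of_existence_of_wardStrict hE h7

/-! ## Cross-route edges: route PrimaryAtInfinity's Ward-content cruxes (items 5352, 5353) -/

open Classical in
/-- **Every normalised non-degenerate pointwise limit satisfies the weak special-conformal Ward identities, given items 5352 and 5353.**
The isotropic two-point law `S 2 ![a,b] = S 2 ![0,e₀] ‖a − b‖^(−2Δ)` with `Δ ∈ [1/2, 3/4]` and the scale covariance of the limit are
theorems for ANY such limit (`twoPoint_structure_of_limit`: self-similarity of full-filter limits, the Ising window, nine-mirror RP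
rigidity), so `FirstMultipoleIdentity` (5352) and `FarFieldClustering` (5353) feed `multipoleToWard_proof` (5356) directly.
[cite: FrancescoMathieuSenechal1997, §4.2–4.3] -/
theorem sctWardWeak_of_multipole (h₁ : PrimaryAtInfinity.FirstMultipoleIdentity) (h₂ : PrimaryAtInfinity.FarFieldClustering)
    {ρ : ℝ → ℝ} {S : CorrFamily 3} (hρ : ∀ δ ∈ Set.Ioc (0:ℝ) 1, 0 < ρ δ)
    (hlim : HasPointwiseScalingLimit (criticalCorr 3) ρ S) (hnorm : ∀ n z, z ∉ NonCoincident 3 n → S n z = 0)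
    (hnd : IsNondegenerateTwoPoint S) :
    ∃ Δ : ℝ, Δ ∈ Set.Icc (1 / 2 : ℝ) (3 / 4) ∧ IsScaleCovariant Δ S ∧ ∀ n, SCTWardWeak S Δ n := by
  obtain ⟨Δ, hwin, -, hscT, -, hlaw⟩ := twoPoint_structure_of_limit hρ hlim hnd
  have hTS : (fun n x => if x ∈ NonCoincident 3 n then S n x else 0) = S := by
    funext n x
    split_ifs with hx
    · rfl
    · exact (hnorm n x hx).symm
  rw [hTS] at hscT
  set c : ℝ := S 2 ![0, axisUnit] with hc_def
  have hc : 0 < c := hnd _ zero_axisUnit_mem_nonCoincident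
  have hS2 : ∀ a b : EuclideanSpace ℝ (Fin 3), a ≠ b → S 2 ![a, b] = c * ‖a - b‖ ^ (-(2 * Δ)) :=
    fun a b hab => hlaw a b hab
  have hcont : ∀ n, ContinuousOn (S n) (NonCoincident 3 n) := continuousOn_of_limit hlim
  have hward := multipoleToWard_proof S c Δ hc.ne' hcont (fun n => by
    obtain ⟨A₀, A₁, hA, hid⟩ := h₁ ρ S c Δ hρ hlim hnorm hc hS2 (n + 1)
    obtain ⟨hmono, hdip⟩ := h₂ ρ S c Δ hρ hlim hnorm hc hS2 n A₀ A₁ hA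
    exact ⟨A₀, A₁, hA, hid, hmono, hdip⟩)
  exact ⟨Δ, hwin, hscT, fun n => (sctWardWeak_three_iff S Δ n).2 (hward n)⟩

/-- **Item 1982 ⇐ items 5352 ∧ 5353** (no existence hypothesis): a normalised non-degenerate Euclidean scale-covariant pointwise limit
satisfies the Ward identities with its two-point dimension (`sctWardWeak_of_multipole`), which equals the given `Δ` (`delta_unique`),
and the door gives inversion covariance. [cite: FrancescoMathieuSenechal1997, §4.3.1 eq. (4.62)] -/
theorem inversionUpgradeNormalised_of_multipole : Summit.CriticalPhenomena.Ising3DConformalLimit.Theses.PrimaryAtInfinity.FirstMultipoleIdentity → Summit.CriticalPhenomena.Ising3DConformalLimit.Theses.PrimaryAtInfinity.FarFieldClustering → Summit.CriticalPhenomena.Ising3DConformalLimit.Theses.HyperoctahedralRP.InversionUpgradeNormalised := by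
  intro h₁ h₂ ρ Δ S hρ hlim hnorm hnd heuc hsc
  obtain ⟨Δ', -, hsc', hW⟩ := sctWardWeak_of_multipole h₁ h₂ hρ hlim hnorm hnd
  have hΔ : Δ = Δ' := delta_unique hρ hlim hnd hsc hρ hlim hnd hsc'
  subst hΔ
  exact (isMoebiusCovariant_of_limit_of_sctWardWeak hlim hnorm heuc hW).isInversionCovariant

open Classical in
/-- **The crux ⇐ BARE existence (item 4738 `WeylWindow.LimitExists`) ∧ items 5352 ∧ 5353.** Truncate the limit off `NonCoincident`
(`regular_of_hasPointwiseScalingLimit`: still a limit, normalised, translation and parity invariant, continuous off the diagonals),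
read off its dimension `Δ ≥ 1/2 > 0`, its scale covariance and its Ward identities (`sctWardWeak_of_multipole`), and integrate
(`isMoebiusCovariant_of_sctWardWeak`). [cite: DuminilCopinICM2022, §8.4] -/
theorem MoebiusLimitExists_of_limitExists_of_multipole (hL : WeylWindow.LimitExists)
    (h₁ : PrimaryAtInfinity.FirstMultipoleIdentity) (h₂ : PrimaryAtInfinity.FarFieldClustering) :
    PerfectScreening.MoebiusLimitExists := by
  obtain ⟨ρ, S, hρ, hlim, hnd⟩ := hL
  obtain ⟨hlimT, -, hnormT, htrT, hparT, hcontT⟩ :=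
    PrecisionLaplacianMoebiusLimitOfTwoPointLaw.regular_of_hasPointwiseScalingLimit hlim
  set T : CorrFamily 3 := fun n x => if x ∈ NonCoincident 3 n then S n x else 0 with hT
  have hndT : IsNondegenerateTwoPoint T := fun x hx => by
    simp only [hT, if_pos hx]
    exact hnd x hx
  obtain ⟨Δ, hwin, -, hW⟩ := sctWardWeak_of_multipole h₁ h₂ hρ hlimT hnormT hndT
  have hM : IsMoebiusCovariant Δ T := isMoebiusCovariant_of_sctWardWeak hnormT hcontT htrT hparT hW
  exact ⟨ρ, Δ, T, hρ, by linarith [hwin.1], hlimT, hndT, hM⟩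

/-- **The crux ⇐ item 1981 ∧ items 5352 ∧ 5353** (1981 gives bare existence). [cite: DuminilCopinICM2022, §8.4] -/
theorem MoebiusLimitExists_of_existence_of_multipole (hE : HyperoctahedralRP.ExistsScaleCovariantLimit)
    (h₁ : PrimaryAtInfinity.FirstMultipoleIdentity) (h₂ : PrimaryAtInfinity.FarFieldClustering) :
    PerfectScreening.MoebiusLimitExists := by
  obtain ⟨ρ, _, S, hρ, _, hlim, _, hnd, _, _⟩ := hE
  exact MoebiusLimitExists_of_limitExists_of_multipole ⟨ρ, S, hρ, hlim, hnd⟩ h₁ h₂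

/-- **Given items 5352 ∧ 5353 the crux IS bare existence**: `MoebiusLimitExists ↔ WeylWindow.LimitExists` (the crux returns item 4738 by
forgetting `Δ` and the covariance). [cite: DuminilCopinICM2022, §8.4] -/
theorem MoebiusLimitExists_iff_limitExists_of_multipole (h₁ : PrimaryAtInfinity.FirstMultipoleIdentity)
    (h₂ : PrimaryAtInfinity.FarFieldClustering) :
    PerfectScreening.MoebiusLimitExists ↔ WeylWindow.LimitExists :=
  ⟨fun ⟨ρ, _, S, hρ, _, hlim, hnd, _⟩ => ⟨ρ, S, hρ, hlim, hnd⟩,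
    fun hL => MoebiusLimitExists_of_limitExists_of_multipole hL h₁ h₂⟩

/-- Route PlantedPinning's spelling of the bare-existence edge. [cite: DuminilCopinICM2022, §8.4] -/
theorem plantedPinning_MoebiusLimitExists_of_limitExists_of_multipole (hL : WeylWindow.LimitExists)
    (h₁ : PrimaryAtInfinity.FirstMultipoleIdentity) (h₂ : PrimaryAtInfinity.FarFieldClustering) :
    PlantedPinning.MoebiusLimitExists :=
  MoebiusLimitExists_of_limitExists_of_multipole hL h₁ h₂

/-- Route SubPtolemyInterlacing's spelling of the bare-existence edge. [cite: DuminilCopinICM2022, §8.4] -/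
theorem subPtolemyInterlacing_MoebiusLimit_of_limitExists_of_multipole (hL : WeylWindow.LimitExists)
    (h₁ : PrimaryAtInfinity.FirstMultipoleIdentity) (h₂ : PrimaryAtInfinity.FarFieldClustering) :
    SubPtolemyInterlacing.MoebiusLimit :=
  MoebiusLimitExists_of_limitExists_of_multipole hL h₁ h₂

/-- Route EnergyNotSigmaSquared's spelling of the bare-existence edge (the primary host route of the crux, decl `MoebiusLimit`).
[cite: DuminilCopinICM2022, §8.4] -/
theorem energyNotSigmaSquared_MoebiusLimit_of_limitExists_of_multipole (hL : WeylWindow.LimitExists)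
    (h₁ : PrimaryAtInfinity.FirstMultipoleIdentity) (h₂ : PrimaryAtInfinity.FarFieldClustering) :
    EnergyNotSigmaSquared.MoebiusLimit :=
  MoebiusLimitExists_of_limitExists_of_multipole hL h₁ h₂

end Summit.CriticalPhenomena.Ising3DConformalLimit.MoebiusLimitExistsWardDoor

end
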